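import Mathlib
import Summits.ValiantsHypothesis.ValiantsHypothesis.Theorems.ElementaryWordLengthWordLengthQPStubUnivariateReduction

/-!
# Crux `WordLengthQP` (stmt-ValiantsHypothesis-6623), line `positive-monoid-exits` —
stub `stub_restriction`: restricting variables never increases exits

RESTRICTION OF VARIABLES.  A real affine elementary word of width 3 is a list of letters
`l = (i, j, c, o) : Fin 3 × Fin 3 × ℝ × Option σ` with matrix `E_ij(c)` (`o = none`) or
`E_ij(c · x_v)` (`o = some v`), i.e. `Matrix.transvection i j (C c * o.elim 1 X)`; the value of a
word is the product of its letter matrices, the word is valid if `i ≠ j` letterwise, and its EXITS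
are the letters that are not (positive coefficient and adjacent, `|i - j| = 1`).  A restriction
`e : σ → Option (Option τ)` substitutes, variable by variable, `x_v ↦ 0` (`e v = none`),
`x_v ↦ 1` (`e v = some none`) or `x_v ↦ x_u` (`e v = some (some u)`), i.e. it is the `ℝ`-algebra
homomorphism `MvPolynomial.aeval g`, `g v = (e v).elim 0 (fun o => o.elim 1 X)`.  Letterwise: a
letter `E_ij(c · x_v)` with `e v = none` becomes `E_ij(0) = 1` and is DELETED (keeping it as a
zero letter would create an exit), every other letter is relabelled with the same `(i, j, c)`.
Hence a valid word for `E₀₂(F)` restricts to a valid word for `E₀₂(aeval g F)` with at most as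
many exits and at most the same length.

Proof: push the entrywise ring homomorphism `(aeval g).toRingHom.mapMatrix` through the product
(`univariateReduction_mapMatrix_wordProd`), identify the image of each letter with the matrix of
the relabelled letter (or with `1` for a deleted letter, `Matrix.transvection_zero`), and compare
the two products by an induction over the word (`restriction_prod_filterMap`).  The exit count
and the length are monotone under `List.filterMap` of a map preserving `(i, j, c)`.

References: functoriality of elementary matrices under ring homomorphisms is folklore; the word
model is the width-3 register machine of Ben-Or–Cleve, *Computing algebraic formulas using a
constant number of registers* (1992).
-/

-- `Summit.ValiantsHypothesis.ValiantsHypothesis.…` is the tree's mandated single-conjunct layout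
-- (Sub = Summit), so the duplicated namespace component is intended.
set_option linter.dupNamespace false

noncomputable section

namespace Summit.ValiantsHypothesis.ValiantsHypothesis.Cruxes.WordLengthQP.PositiveMonoidExits

/-- The letterwise restriction step along `e : σ → Option (Option τ)` is the function
`l ↦ l.2.2.2.elim (some (l.1, l.2.1, l.2.2.1, none)) (fun v => (e v).map (fun o => (l.1, l.2.1,
l.2.2.1, o)))` (inlined everywhere): a constant letter is kept, a letter in the variable `x_v` is
deleted if `e v = none` (`x_v ↦ 0`) and otherwise relabelled by `o : Option τ` (`x_v ↦ 1` for
`o = none`, `x_v ↦ x_u` for `o = some u`).  A kept letter has the same `(i, j, c)` as the letter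
it comes from. -/
theorem restriction_step_eq_some {σ τ : Type} (e : σ → Option (Option τ))
    (a : Fin 3 × Fin 3 × ℝ × Option σ) (b : Fin 3 × Fin 3 × ℝ × Option τ)
    (h : a.2.2.2.elim (some (a.1, a.2.1, a.2.2.1, none))
      (fun v => (e v).map (fun o => (a.1, a.2.1, a.2.2.1, o))) = some b) :
    b.1 = a.1 ∧ b.2.1 = a.2.1 ∧ b.2.2.1 = a.2.2.1 := by
  obtain ⟨i, j, c, _ | v⟩ := a
  · simp only [Option.elim_none, Option.some.injEq] at h
    subst h
    simp
  · simp only [Option.elim_some, Option.map_eq_some_iff] at h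
    obtain ⟨o, -, rfl⟩ := h
    simp

/-- Products along `List.filterMap`: if the deleted items have value `1` and the kept items keep
their value, the product over the filtered list equals the product over the original list. -/
theorem restriction_prod_filterMap {α β M : Type*} [Monoid M] (step : α → Option β) (f : α → M)
    (f' : β → M) (h1 : ∀ a, step a = none → f a = 1)
    (h2 : ∀ a b, step a = some b → f a = f' b) (w : List α) :
    (w.map f).prod = ((w.filterMap step).map f').prod := by
  induction w with
  | nil => rfl
  | cons a w ih =>
    cases hs : step a with
    | none =>
      rw [List.filterMap_cons_none hs, List.map_cons, List.prod_cons, h1 a hs, one_mul, ih]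
    | some b =>
      rw [List.filterMap_cons_some hs, List.map_cons, List.map_cons, List.prod_cons,
        List.prod_cons, h2 a b hs, ih]

/-- Counting along `List.filterMap`: if a predicate on kept items agrees with a predicate on the
items they come from, the filtered list has at most as many items satisfying it. -/
theorem restriction_length_filter_filterMap_le {α β : Type*} (step : α → Option β)
    (p : α → Bool) (q : β → Bool) (h : ∀ a b, step a = some b → q b = p a) (w : List α) :
    ((w.filterMap step).filter q).length ≤ (w.filter p).length := by
  induction w with
  | nil => simp
  | cons a w ih =>
    cases hs : step a with
    | none =>
      rw [List.filterMap_cons_none hs, List.filter_cons]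
      split_ifs
      · rw [List.length_cons]; omega
      · exact ih
    | some b =>
      rw [List.filterMap_cons_some hs, List.filter_cons, List.filter_cons, h a b hs]
      split_ifs
      · rw [List.length_cons, List.length_cons]; omega
      · exact ih

/-- **Restriction of variables.**  Substituting, variable by variable, `x_v ↦ 0`
(`e v = none`: the letter becomes the identity and is deleted), `x_v ↦ 1` (`e v = some none`:
the letter becomes a constant letter) or `x_v ↦ x_u` (`e v = some (some u)`) maps a valid real
word for `E₀₂(F)` to a valid real word for `E₀₂(F|_e)`,
`F|_e = aeval (fun v => (e v).elim 0 (fun o => o.elim 1 X)) F`, over the new variables without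
increasing the number of exits or the length (the exit status of a kept letter depends on
`(i, j, c)` only).  This is the 0/1-restriction behind `κ(per_n) ≥ κ(x₁₁⋯x_nn) ≥ κ₁(tⁿ)` and
subsumes the univariate reduction. [folklore; word model: Ben-Or–Cleve 1992] -/
theorem stub_restriction {σ τ : Type} (e : σ → Option (Option τ)) (F : MvPolynomial σ ℝ)
    (w : List (Fin 3 × Fin 3 × ℝ × Option σ)) (hw : ∀ l ∈ w, l.1 ≠ l.2.1)
    (hF : (w.map (fun l => Matrix.transvection l.1 l.2.1
        (MvPolynomial.C l.2.2.1 * l.2.2.2.elim 1 MvPolynomial.X))).prod =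
        Matrix.transvection (0 : Fin 3) 2 F) :
    ∃ w' : List (Fin 3 × Fin 3 × ℝ × Option τ), (∀ l ∈ w', l.1 ≠ l.2.1) ∧
      (w'.map (fun l => Matrix.transvection l.1 l.2.1
        (MvPolynomial.C l.2.2.1 * l.2.2.2.elim 1 MvPolynomial.X))).prod =
        Matrix.transvection (0 : Fin 3) 2
          (MvPolynomial.aeval (fun v => (e v).elim (0 : MvPolynomial τ ℝ)
            (fun o => o.elim 1 MvPolynomial.X)) F) ∧
      (w'.filter (fun l => !decide (0 < l.2.2.1 ∧
          (l.1.val + 1 = l.2.1.val ∨ l.2.1.val + 1 = l.1.val)))).length ≤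
        (w.filter (fun l => !decide (0 < l.2.2.1 ∧
          (l.1.val + 1 = l.2.1.val ∨ l.2.1.val + 1 = l.1.val)))).length ∧
      w'.length ≤ w.length := by
  refine ⟨w.filterMap (fun l => l.2.2.2.elim (some (l.1, l.2.1, l.2.2.1, none))
      (fun v => (e v).map (fun o => (l.1, l.2.1, l.2.2.1, o)))), ?_, ?_, ?_,
    List.length_filterMap_le _ _⟩
  · -- validity: a kept letter has the `(i, j)` of the letter it comes from
    intro l hl
    obtain ⟨a, ha, hstep⟩ := List.mem_filterMap.1 hl
    obtain ⟨h1, h2, -⟩ := restriction_step_eq_some e a l hstep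
    rw [h1, h2]
    exact hw a ha
  · -- the product: functoriality of words under `aeval`, deleted letters are identities
    have key := congrArg (MvPolynomial.aeval (fun v => (e v).elim (0 : MvPolynomial τ ℝ)
      (fun o => o.elim 1 MvPolynomial.X))).toRingHom.mapMatrix hF
    rw [univariateReduction_mapMatrix_wordProd, RingHom.mapMatrix_apply,
      univariateReduction_transvection_map] at key
    simp only [AlgHom.toRingHom_eq_coe, RingHom.coe_coe, MvPolynomial.aeval_X,
      MvPolynomial.algHom_C, MvPolynomial.algebraMap_eq] at key
    refine Eq.trans (restriction_prod_filterMap _ _ _ ?_ ?_ w).symm key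
    · -- deleted letters: `E_ij(c · 0) = 1`
      rintro ⟨i, j, c, _ | v⟩ h
      · simp at h
      · simp only [Option.elim_some, Option.map_eq_none_iff] at h
        simp [h]
    · -- kept letters: the image is the matrix of the relabelled letter
      rintro ⟨i, j, c, _ | v⟩ b h
      · simp only [Option.elim_none, Option.some.injEq] at h
        subst h
        simp
      · simp only [Option.elim_some, Option.map_eq_some_iff] at h
        obtain ⟨o, ho, rfl⟩ := h
        simp [ho]
  · -- exits: the exit predicate only reads `(i, j, c)`, deleted letters only lower the count
    refine restriction_length_filter_filterMap_le _ _ _ (fun a b h => ?_) w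
    obtain ⟨h1, h2, h3⟩ := restriction_step_eq_some e a b h
    simp only [h1, h2, h3]

end Summit.ValiantsHypothesis.ValiantsHypothesis.Cruxes.WordLengthQP.PositiveMonoidExits

end
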